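import Summits.BirchSwinnertonDyer.BirchSwinnertonDyer.Theorems.PrintCf2SplitBadPrimeTwistSlices
import HarnessLib

set_option linter.dupNamespace false -- `…BirchSwinnertonDyer.BirchSwinnertonDyer…` is the cell's namespace (D-0017)

/-!
# Route PrintCf2 — aside `SplitBadPrimeTwistsOfFactsPlus` (item 25976) closed

The K7t aside `SplitBadPrimeTwistsOfFactsPlus` of route `PrintCf2` (rev 21; banked context for the
crux `SplitBadTwoRankOneOfFacts`, item 20368) says: granted the split-bad fact bundle 𝔅_split and ten
named printed facts (Cai–Shu–Tian 2014 Thm 1.1, Coates–Li–Tian–Zhai 2015 Thms 1.2/4.4/1.4, the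
small-conductor BSD triple, newform existence, the optimal-curve Manin certificate of `cm7` = 49a1,
Gross–Zagier and Kolyvagin at every level, the X₀(49) η-descent norm fact), every globally minimal CM
curve `W/ℚ` of analytic rank one with 2 split in the CM field and bad at 2 that lies in one of the
printed prime-twist families `cm7^(−q)` (`q ≡ 1 (mod 4)`, `(q/−7)`-condition as typed) or
`cm7^(−2q)` (`q > 3`) satisfies `BSDp W 2`.

It is decided in the tree by
`Summit.BirchSwinnertonDyer.BirchSwinnertonDyer.Theorems.PrintCf2.bsdp_two_of_primeTwist_of_print`
(module `PrintCf2SplitBadPrimeTwistSlices`); this file is the one-term closer whose type is the route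
declaration verbatim. No statement of the summit is proved here; BSD is not proved by any of this.
-/

namespace Summit.BirchSwinnertonDyer.BirchSwinnertonDyer.Theorems.PrintCf2

/-- The aside `PrintCf2.SplitBadPrimeTwistsOfFactsPlus` (item stmt-BirchSwinnertonDyer-25976) holds:
unpack the two bundles and apply `bsdp_two_of_primeTwist_of_print` (the binders `HasCM`,
`analyticRank = 1`, `CMSplit W 2`, `¬ Good W 2` of the conclusion are idle — membership in a printed
prime-twist family already decides `BSDp W 2`). -/
theorem splitBadPrimeTwistsOfFactsPlus_proof :
    Summit.BirchSwinnertonDyer.BirchSwinnertonDyer.Theses.PrintCf2.SplitBadPrimeTwistsOfFactsPlus :=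
  fun ⟨hB, hCST, h12, h44, h14, hS31, hnf, hM, hGZ, hKo, hEta⟩ W _ _ _ _ _ _ hmem ↦
    bsdp_two_of_primeTwist_of_print hCST h12 h44 h14 hS31 hnf hM hB.2.2.2.1 hGZ hKo hB.1 hEta W hmem

end Summit.BirchSwinnertonDyer.BirchSwinnertonDyer.Theorems.PrintCf2
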